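import Summits.AtomisticToContinuum.HydrodynamicLimit.Theses.OneFlightGossipEngine
import Summits.AtomisticToContinuum.HydrodynamicLimit.Theses.BGEndpointRigidity
import Summits.AtomisticToContinuum.HydrodynamicLimit.Theorems.OneFlightGossipEngineCollisionActivityTailsActMeasurable
import Summits.AtomisticToContinuum.HydrodynamicLimit.Theorems.JParityClosureCollisionTightnessDomination
import Literature.MathematicalPhysics.KineticTheory.LocalGibbsConstEquivalence
import HarnessLib

/-!
# `CollisionActivityTails` (stmt-AtomisticToContinuum-13734), line `plaque-thinning-count-ld`:
# stub `stub_entropyTransfer` — the entropy inequality at time zero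

Helper file (`--supports stmt-AtomisticToContinuum-13734`) for the crux
`Summit.AtomisticToContinuum.HydrodynamicLimit.Theses.OneFlightGossipEngine.CollisionActivityTails`, skeleton line
`plaque-thinning-count-ld` (`Cruxes/CollisionActivityTails/Lines/plaque_thinning_count_ld.lean`), registered stub
`stub_entropyTransfer : EquilibriumUntaggedActivityLMGF → UntaggedActivityTails` (vocabulary of
`Theorems/OneFlightGossipEngineCollisionActivityTailsPlaqueSplit.lean`, copied verbatim in §0 — see there).

The hypothesis controls the untagged-activity tail sum `F = Σᵢ 𝟙{V < uncActᵢ} uncActᵢ ≥ 0` at EQUILIBRIUM by an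
exponential moment `∫ e^{γF} dG_N ≤ e^{δ(N+1)}` under the global Gibbs law
`G_N = gibbs σ a θ N Φ = localGibbsLaw σ a 0 θ N Φ`, for every `γ, δ > 0` after `τ ≥ τ₀(γ, δ)`.  The conclusion is
the mean bound `E_{λ₀}[(N+1)⁻¹ F] ≤ η` under the TRUE local Gibbs law `λ₀ = localGibbsLaw σ a₀ u₀ θ₀ N Φ`
(continuous positive profiles).  Both are laws of the initial datum, `F` is one fixed function of it: no dynamics
enters, only the change of measure `λ₀ → G_N` — the entropy inequality
`E_{λ₀}[γF] ≤ H(λ₀ | G_N) + log E_{G_N}[e^{γF}]` with `H(λ₀ | G_N) ≤ κ (N+1)`.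

Proof (elementary form, no `klDiv`).
* Reference and entropy budget: by `exists_profile_bounds` / `exists_localGibbsProfile_le_const` /
  `canonicalDensity_le_const_mul` (`Theorems/JParityClosureCollisionTightnessDomination.lean`) the canonical density
  `p` of `λ₀` and the canonical density `q` of the homogeneous law `G_N` with unit activity and temperature
  `θ₁ = 2 sup θ₀` satisfy the POINTWISE bound `p ≤ Λ^{N+1} q` (`Λ ≥ 1`, uniformly in `σ ≤ 1/2` and `N`); this is
  the order-`N` bound on `log dλ₀/dG_N`.
* Entropy inequality, pointwise: for `0 ≤ p ≤ L q` and real `t, c`,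
  `p t ≤ p (c + log L) + q e^{t - c}` (`mul_le_add_mul_exp`: `y ≤ e^y` at `y = t - c - log L`).  Integrating
  against Lebesgue measure with `t = γF`, `c = δ(N+1)`, `L = Λ^{N+1}` and using `λ₀(univ) ≤ 1`,
  `∫ e^{γF} dG_N ≤ e^{δ(N+1)}`:  `∫ γF dλ₀ ≤ δ(N+1) + (N+1) log Λ + 1` (`lintegral_withDensity_le_of_exp_moment`).
* Bookkeeping: `δ := 1`, `γ := (log Λ + 2)/η`, so `E_{λ₀}[(N+1)⁻¹ F] ≤ (1 + log Λ + 1)/γ ≤ η`; the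
  a.e.-measurability conjunct transfers along `λ₀ ≪ G_N` (`localGibbsLaw_absolutelyContinuous_localGibbsLaw`).

References: C. Kipnis, C. Landim, *Scaling Limits of Interacting Particle Systems* (1999), App. 1 §8 (entropy
inequality); H. Spohn, *Large Scale Dynamics of Interacting Particles* (1991), Part I §2.3 (local equilibrium vs.
equilibrium: relative entropy of order `N`).  Elementary; recorded here.
-/

noncomputable section

open MeasureTheory Set Filter Topology
open scoped ENNReal

namespace Summit.AtomisticToContinuum.HydrodynamicLimit.Theorems.CollisionActivityTailsEntropyTransfer

open Literature.MathematicalPhysics.KineticTheory Literature.Analysis.FluidPDE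
open Summit.AtomisticToContinuum.HydrodynamicLimit.Theorems.CollisionActivityTailsActivityDomination
  (Flow Cfg window act tdist nearCount)
open Summit.AtomisticToContinuum.HydrodynamicLimit.Theorems.CollisionActivityTailsNearFieldKineticTails
  (tailFn tailFn_of_lt tailFn_of_le tailFn_nonneg)

/-! ## §0 Vocabulary of the line — VERBATIM copy of `Theorems/OneFlightGossipEngineCollisionActivityTailsPlaqueSplit.lean`
§0/§1 (same names, bodies, `open`s, `variable`s), restricted to what this stub mentions

The line's shared vocabulary file `…CollisionActivityTailsPlaqueSplit` (p128811) is landed; this file carries a verbatim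
copy of the needed part in its own namespace (the skeleton bridges the two copies definitionally — every body below is
syntactically the PlaqueSplit body over the same landed constants `Flow`, `Cfg`, `window`, `tdist`, `nearCount`, `tailFn`). -/

variable {σ : ℝ} {N : ℕ}

/-- The global Gibbs law (constant activity `a₀`, zero drift, temperature `θ₀`) — the equilibrium reference `G_N`. -/
def gibbs (σ a₀ θ₀ : ℝ) (N : ℕ) (Φ : Flow σ N) : Measure (Cfg N) :=
  localGibbsLaw σ (fun _ => a₀) (fun _ => 0) (fun _ => θ₀) N Φ

/-- The collision record of the ordered pair `(k, l)` read off the (post-collisional) configuration `y` at time `t`. -/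
abbrev rec (σ : ℝ) (N : ℕ) (y : Cfg N) (t : ℝ) (k l : Fin (N + 1)) : HardSphereCollisionRecord (Fin 3) T3 (N + 1) :=
  HardSphereCollisionRecord.ofConfig (Torus.geometry (Fin 3)) (hsDiameter σ N) y t k l

/-- The impulse `|v_k⁺ - v_k⁻|` received by the first particle of the ordered contact pair `(k, l)` (the crux's summand). -/
def imp (σ : ℝ) (N : ℕ) (y : Cfg N) (t : ℝ) (k l : Fin (N + 1)) : ℝ :=
  ‖(rec σ N y t k l).postVel.1 - (rec σ N y t k l).preVel.1‖

/-- Relative speed of the pair `(k, l)` in the configuration `y` (equal in norm before and after an elastic collision). -/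
def relSpeed (y : Cfg N) (k l : Fin (N + 1)) : ℝ := ‖(y k).2 - (y l).2‖

/-- Radius of the ball of MEAN occupancy `K'` (unit torus, `N + 1` centres): `(4π/3) r³ (N+1) = K'`. -/
def scaleRadius (N K' : ℕ) : ℝ := (3 * (K' : ℝ) / (4 * Real.pi * ((N : ℝ) + 1))) ^ (1 / 3 : ℝ)

/-- Kinetic energy (twice) carried by the centres within distance `r` of particle `i` (itself included). -/
def ballKinetic (y : Cfg N) (i : Fin (N + 1)) (r : ℝ) : ℝ :=
  ∑ j : Fin (N + 1), if tdist (y j).1 (y i).1 ≤ r then ‖(y j).2‖ ^ 2 else 0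

/-- Particle `i` is **tagged** (threshold `y`, minimal scale `K`) in the configuration `cfg`: at some scale `K' ≥ max K 1` the
ball of mean occupancy `K'` around `i` holds at least `y K'` centres OR kinetic energy at least `y K'` — `i` sits in a
region that is over-dense or over-heated by the factor `y` at a scale holding `≥ K'` mean particles. Instantaneous, multi-scale
(triage r2-2 S1): macroscopic droplets / blobs / hot spots are tagged at their own scale whatever `K`; incidental small clusters
(fewer than `y K` members) are not. Benign degenerate instances: for `y ≤ 1` every particle tags itself (`nearCount ≥ 1`), and for
`y` below twice the mean kinetic energy per particle the whole-torus scales tag everybody — then `uncAct ≡ 0` and the untagged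
statements below hold trivially; they are CONSUMED only at the threshold `y₀` produced by `AbnormalActivityVanishes` (large), and
for `N ≥ N₀ > K` so that local scales `K ≤ K' ≤ N` exist. -/
def Tagged (y : ℝ) (K : ℕ) (cfg : Cfg N) (i : Fin (N + 1)) : Prop :=
  ∃ K' : ℕ, K ≤ K' ∧ 1 ≤ K' ∧
    (y * K' ≤ (nearCount cfg i (scaleRadius N K') : ℝ) ∨ y * K' ≤ ballKinetic cfg i (scaleRadius N K'))

open scoped Classical in
/-- **Untagged cold activity** `uncAct`: `(σ/τ) Σ |Δv_i|` over the collisions of `i` in `(s, s+w]` with relative speed `≤ Θ`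
at which `i` is NOT tagged — the recurrent branch the one-flight engine controls. -/
def uncAct (Θ y : ℝ) (K : ℕ) (Φ : Flow σ N) (τ s : ℝ) (i : Fin (N + 1)) (z : Cfg N) : ℝ :=
  σ / τ * Φ.collisionPairSum (Set.Ioc s (s + window τ N))
    (fun t cfg k l => if k = i ∧ relSpeed cfg k l ≤ Θ ∧ ¬ Tagged y K cfg i then imp σ N cfg t k l else 0) z

/-! ### The two branch statements linked by this stub (verbatim from PlaqueSplit §1) -/

/-- **EQUILIBRIUM EXPONENTIAL MOMENT OF THE UNTAGGED-ACTIVITY TAIL SUM** (conclusion of stub 2, hypothesis of stub 3): under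
the global Gibbs law, for `0 < σ < σ₀` and every tagging threshold `y > 0` there is a level `V₀ = V₀(a₀, θ₀, σ, y)` such that
for `V ≥ V₀`, EVERY cold cap `Θ`, EVERY minimal tagging scale `K`, every `γ > 0` and `δ > 0`, for `τ ≥ τ₀` and
`N ≥ N₀`, all flows and all window starts `s ≥ 0`:
`∫ exp(γ Σ_i 𝟙{V < uncAct_i} uncAct_i) dG_N ≤ exp(δ (N+1))` (with the a.e.-measurability of the tail sum). The order is the
content: `V₀` before `Θ, K, γ, δ` (a macroscopic warm or dense region is tagged at its own scale, an untagged one has bounded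
`density × temperature` hence bounded activity rate; transient sub-scale clusters cost `τ₀(K, Θ)` only), `γ → ∞` admissible
because the equilibrium cost of an untagged activity hub GROWS WITH `τ` (Bennett: `≥ Vτ/(σΘ)` aimed cold arrivals,
each of conditional probability `≤ C min(1,S)` by stub 1, in ONE global filtration so that the exponential supermartingale is a
product over particles — triage r2-1 G1), `s`-uniform by invariance of `G_N`. -/
def EquilibriumUntaggedActivityLMGF : Prop :=
  ∀ (a₀ θ₀ : ℝ), 0 < a₀ → 0 < θ₀ → ∃ σ₀ : ℝ, 0 < σ₀ ∧ ∀ σ : ℝ, 0 < σ → σ < σ₀ →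
    ∀ y : ℝ, 0 < y → ∃ V₀ : ℝ, 0 < V₀ ∧ ∀ V : ℝ, V₀ ≤ V → ∀ Θ : ℝ, 0 < Θ → ∀ K : ℕ,
    ∀ γ : ℝ, 0 < γ → ∀ δ : ℝ, 0 < δ → ∃ τ₀ : ℝ, 0 < τ₀ ∧ ∀ τ : ℝ, τ₀ ≤ τ → ∃ N₀ : ℕ, ∀ N : ℕ, N₀ ≤ N →
    ∀ (Φ : Flow σ N) (s : ℝ), 0 ≤ s →
      AEMeasurable (fun z => ∑ i : Fin (N + 1), tailFn V (uncAct Θ y K Φ τ s i z)) (gibbs σ a₀ θ₀ N Φ) ∧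
      ∫⁻ z, ENNReal.ofReal (Real.exp (γ * ∑ i : Fin (N + 1), tailFn V (uncAct Θ y K Φ τ s i z)))
          ∂(gibbs σ a₀ θ₀ N Φ) ≤ ENNReal.ofReal (Real.exp (δ * ((N : ℝ) + 1)))

/-- **UNTAGGED ACTIVITY TAILS under the true law** (conclusion of stub 3; first hypothesis of the composition): the crux's
own frame and quantifier shape for the untagged cold activity `uncAct Θ y K`, with the tagging threshold `y` fixed BEFORE the
level `V₀ = V₀(y)` and the caps `Θ, K` fixed AFTER the level and before `τ₀` (they only delay `τ₀`). Obtained from the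
equilibrium exponential moment by the entropy inequality AT TIME ZERO against the global Gibbs reference `G_N` with
`θ_ref > sup θ₀`: `E_{λ₀}[(N+1)⁻¹ Σ tail] ≤ (H(λ₀|G_N)/(N+1) + δ)/γ ≤ (κ + δ)/γ`, `γ → ∞` after `τ → ∞` — legitimate ONLY
because the equilibrium per-hub cost grows with `τ` (outside the CountingCeiling, whose families are tagged). Carries the
a.e.-measurability of the tail sum (the composition splits one `lintegral`). -/
def UntaggedActivityTails : Prop :=
  ∀ (a₀ θ₀ : T3 → ℝ) (u₀ : T3 → V3), Continuous a₀ → Continuous θ₀ → Continuous u₀ →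
    (∀ x, 0 < a₀ x) → (∀ x, 0 < θ₀ x) → ∃ σ₀ : ℝ, 0 < σ₀ ∧ ∀ σ : ℝ, 0 < σ → σ < σ₀ →
    ∀ (T : ℝ) (ρ θ : ℝ → T3 → ℝ) (u : ℝ → T3 → V3), IsHardSphereEulerSolution σ T ρ u θ →
    ∀ Φ : (N : ℕ) → Flow σ N,
    TendstoHydroFieldsAt (fun N => localGibbsLaw σ a₀ u₀ θ₀ N (Φ N)) Φ ρ u θ 0 →
    ∀ t ∈ Set.Ico 0 T, ∀ y : ℝ, 0 < y → ∃ V₀ : ℝ, 0 < V₀ ∧ ∀ V : ℝ, V₀ ≤ V → ∀ Θ : ℝ, 0 < Θ → ∀ K : ℕ,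
    ∀ η : ℝ, 0 < η → ∃ τ₀ : ℝ, 0 < τ₀ ∧ ∀ τ : ℝ, τ₀ ≤ τ → ∃ N₀ : ℕ, ∀ N : ℕ, N₀ ≤ N → ∀ s ∈ Set.Icc 0 t,
      AEMeasurable (fun z => ∑ i : Fin (N + 1), tailFn V (uncAct Θ y K (Φ N) τ s i z))
          (localGibbsLaw σ a₀ u₀ θ₀ N (Φ N)) ∧
      ∫⁻ z, ENNReal.ofReal (((N : ℝ) + 1)⁻¹ * ∑ i : Fin (N + 1), tailFn V (uncAct Θ y K (Φ N) τ s i z))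
        ∂(localGibbsLaw σ a₀ u₀ θ₀ N (Φ N)) ≤ ENNReal.ofReal η

/-! ## §1 The elementary entropy inequality -/

/-- **Young's inequality behind the entropy inequality, pointwise.** For `0 ≤ p ≤ L q` (`L > 0`) and real
`t, c`: `p t ≤ p (c + log L) + q e^{t - c}` — from `y ≤ e^y` at `y = t - c - log L`, multiplied by `p`, and
`p e^{t-c} / L ≤ q e^{t-c}`. With `p, q` the densities of two laws `P ≤ L Q`-pointwise this integrates to
`∫ t dP ≤ (c + log L) P(univ) + e^{-c} ∫ e^t dQ`. -/
theorem mul_le_add_mul_exp {p q L t c : ℝ} (hp : 0 ≤ p) (hL : 0 < L) (hpq : p ≤ L * q) :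
    p * t ≤ p * (c + Real.log L) + q * Real.exp (t - c) := by
  have hy : t - c - Real.log L ≤ Real.exp (t - c - Real.log L) := by
    linarith [Real.add_one_le_exp (t - c - Real.log L)]
  have h1 : p * (t - c - Real.log L) ≤ p * Real.exp (t - c - Real.log L) :=
    mul_le_mul_of_nonneg_left hy hp
  have h2 : Real.exp (t - c - Real.log L) = Real.exp (t - c) / L := by
    rw [Real.exp_sub, Real.exp_log hL]
  have h3 : p * (Real.exp (t - c) / L) ≤ q * Real.exp (t - c) := by
    rw [mul_div_assoc', div_le_iff₀ hL]
    calc p * Real.exp (t - c) ≤ L * q * Real.exp (t - c) :=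
          mul_le_mul_of_nonneg_right hpq (Real.exp_pos _).le
      _ = q * Real.exp (t - c) * L := by ring
  rw [h2] at h1
  linarith

/-- **The entropy inequality in the form used here** (change of measure with an `O(log L)` budget). On a measure
space `(α, ν)` let `P = p · ν`, `Q = q · ν` with measurable densities `0 ≤ p ≤ L q` (`L ≥ 1`) and `P(univ) ≤ 1`.
If `∫⁻ e^{t} dQ ≤ e^{B}` (`B ≥ 0`) for a real function `t` (no measurability needed), then
`∫⁻ t⁺ dP ≤ B + log L + 1` — integrate `mul_le_add_mul_exp` with `c = B`:
`∫ p t dν ≤ (B + log L) ∫ p dν + e^{-B} ∫ q e^{t} dν ≤ (B + log L) + 1`. -/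
theorem lintegral_withDensity_le_of_exp_moment {α : Type*} [MeasurableSpace α] {ν : Measure α}
    {p q : α → ℝ} (hpm : Measurable p) (hqm : Measurable q) (hp0 : ∀ x, 0 ≤ p x) (hq0 : ∀ x, 0 ≤ q x)
    {L : ℝ} (hL : 1 ≤ L) (hpq : ∀ x, p x ≤ L * q x)
    (hP : (ν.withDensity fun x => ENNReal.ofReal (p x)) Set.univ ≤ 1)
    (t : α → ℝ) {B : ℝ} (hB : 0 ≤ B)
    (hmom : ∫⁻ x, ENNReal.ofReal (Real.exp (t x)) ∂(ν.withDensity fun x => ENNReal.ofReal (q x)) ≤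
      ENNReal.ofReal (Real.exp B)) :
    ∫⁻ x, ENNReal.ofReal (t x) ∂(ν.withDensity fun x => ENNReal.ofReal (p x)) ≤
      ENNReal.ofReal (B + Real.log L + 1) := by
  have hlogL : 0 ≤ Real.log L := Real.log_nonneg hL
  have hL0 : 0 < L := one_pos.trans_le hL
  have hpm' : Measurable fun x => ENNReal.ofReal (p x) := hpm.ennreal_ofReal
  have hqm' : Measurable fun x => ENNReal.ofReal (q x) := hqm.ennreal_ofReal
  -- the two reference integrals
  have hPu : ∫⁻ x, ENNReal.ofReal (p x) ∂ν ≤ 1 := by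
    rw [withDensity_apply _ MeasurableSet.univ, Measure.restrict_univ] at hP
    exact hP
  have hQe : ∫⁻ x, ENNReal.ofReal (q x) * ENNReal.ofReal (Real.exp (t x - B)) ∂ν ≤ 1 := by
    have h1 : ∫⁻ x, ENNReal.ofReal (q x) * ENNReal.ofReal (Real.exp (t x - B)) ∂ν =
        ∫⁻ x, ENNReal.ofReal (Real.exp (t x - B)) ∂(ν.withDensity fun x => ENNReal.ofReal (q x)) := by
      rw [lintegral_withDensity_eq_lintegral_mul_non_measurable _ hqm'
        (Eventually.of_forall fun _ => ENNReal.ofReal_lt_top)]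
      rfl
    rw [h1]
    have h2 : ∀ x, ENNReal.ofReal (Real.exp (t x - B)) =
        ENNReal.ofReal ((Real.exp B)⁻¹) * ENNReal.ofReal (Real.exp (t x)) := fun x => by
      rw [← ENNReal.ofReal_mul (inv_nonneg.2 (Real.exp_pos B).le), Real.exp_sub]
      congr 1
      field_simp
    simp_rw [h2]
    rw [lintegral_const_mul' _ _ ENNReal.ofReal_ne_top]
    calc ENNReal.ofReal ((Real.exp B)⁻¹) *
          ∫⁻ x, ENNReal.ofReal (Real.exp (t x)) ∂(ν.withDensity fun x => ENNReal.ofReal (q x))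
        ≤ ENNReal.ofReal ((Real.exp B)⁻¹) * ENNReal.ofReal (Real.exp B) := mul_le_mul_right hmom _
      _ = 1 := by
          rw [← ENNReal.ofReal_mul (inv_nonneg.2 (Real.exp_pos B).le),
            inv_mul_cancel₀ (Real.exp_pos B).ne', ENNReal.ofReal_one]
  -- pointwise Young
  have hpt : ∀ x, ENNReal.ofReal (p x) * ENNReal.ofReal (t x) ≤
      ENNReal.ofReal (p x) * ENNReal.ofReal (B + Real.log L) +
        ENNReal.ofReal (q x) * ENNReal.ofReal (Real.exp (t x - B)) := by
    intro x
    rw [← ENNReal.ofReal_mul (hp0 x), ← ENNReal.ofReal_mul (hp0 x), ← ENNReal.ofReal_mul (hq0 x)]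
    exact (ENNReal.ofReal_le_ofReal (mul_le_add_mul_exp (t := t x) (c := B) (hp0 x) hL0 (hpq x))).trans
      ENNReal.ofReal_add_le
  rw [lintegral_withDensity_eq_lintegral_mul_non_measurable _ hpm'
    (Eventually.of_forall fun _ => ENNReal.ofReal_lt_top)]
  calc ∫⁻ x, ((fun x => ENNReal.ofReal (p x)) * fun x => ENNReal.ofReal (t x)) x ∂ν
      ≤ ∫⁻ x, (ENNReal.ofReal (p x) * ENNReal.ofReal (B + Real.log L) +
          ENNReal.ofReal (q x) * ENNReal.ofReal (Real.exp (t x - B))) ∂ν := lintegral_mono hpt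
    _ = (∫⁻ x, ENNReal.ofReal (p x) * ENNReal.ofReal (B + Real.log L) ∂ν) +
          ∫⁻ x, ENNReal.ofReal (q x) * ENNReal.ofReal (Real.exp (t x - B)) ∂ν :=
        lintegral_add_left (hpm'.mul_const _) _
    _ ≤ ENNReal.ofReal (B + Real.log L) + 1 := by
        refine add_le_add ?_ hQe
        rw [lintegral_mul_const _ hpm']
        calc (∫⁻ x, ENNReal.ofReal (p x) ∂ν) * ENNReal.ofReal (B + Real.log L)
            ≤ 1 * ENNReal.ofReal (B + Real.log L) := mul_le_mul_left hPu _
          _ = ENNReal.ofReal (B + Real.log L) := one_mul _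
    _ = ENNReal.ofReal (B + Real.log L + 1) := by
        rw [ENNReal.ofReal_add (by positivity) zero_le_one, ENNReal.ofReal_one]

/-! ## §2 The entropy budget: pointwise domination of the canonical densities -/

/-- **`log dλ₀/dG_N ≤ (N+1) log Λ`, pointwise.** For continuous profiles `a₀, θ₀ > 0`, `u₀` there are a reference
temperature `θ₁ > 0` and `Λ ≥ 1` such that for every `σ ≤ 1/2` and every `N` the canonical density of the local
Gibbs law is at most `Λ^{N+1}` times the canonical density of the homogeneous law with unit activity, zero drift and
temperature `θ₁` (`canonicalDensity_le_const_mul` with the Gaussian domination `exists_localGibbsProfile_le_const`,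
`θ₁ = 2 sup θ₀`). -/
theorem exists_canonicalDensity_le_pow_mul {a₀ θ₀ : T3 → ℝ} {u₀ : T3 → V3} (ha : Continuous a₀)
    (hθ : Continuous θ₀) (hu : Continuous u₀) (ha0 : ∀ x, 0 < a₀ x) (hθ0 : ∀ x, 0 < θ₀ x) :
    ∃ θ₁ : ℝ, 0 < θ₁ ∧ ∃ Λ : ℝ, 1 ≤ Λ ∧ ∀ σ : ℝ, σ ≤ 1 / 2 → ∀ (N : ℕ) (z : Config (N + 1) (Fin 3) T3),
      canonicalDensity (Torus.geometry (Fin 3)) (hsDiameter σ N) (N + 1) (localGibbsProfile a₀ u₀ θ₀) z ≤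
        Λ ^ (N + 1) * canonicalDensity (Torus.geometry (Fin 3)) (hsDiameter σ N) (N + 1)
          (localGibbsProfile (fun _ => 1) (fun _ => (0 : V3)) (fun _ => θ₁)) z := by
  -- adapted from `exists_localGibbsMeasure_le_smul_const` (JParityClosureCollisionTightnessDomination), pointwise form
  obtain ⟨A, a, Θ, ϑ, U, ha_pos, hϑ0, -, hA, haa, hΘ, hϑ, hU⟩ := exists_profile_bounds ha hθ hu ha0 hθ0
  have hΘ0 : 0 < Θ := hϑ0.trans_le ((hϑ 0).trans (hΘ 0))
  obtain ⟨C, hC0, hC⟩ := exists_localGibbsProfile_le_const (fun x => (ha0 x).le) hA hϑ0 hϑ hΘ hU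
  refine ⟨2 * Θ, by positivity, max (C / a) 1, le_max_right _ _, fun σ hσ N z => ?_⟩
  have hfQ0 : 0 ≤ localGibbsProfile (fun _ => 1) (fun _ => (0 : V3)) (fun _ => 2 * Θ) :=
    fun y => localGibbsProfile_nonneg (fun _ => zero_le_one) (fun _ => by positivity) y
  exact (canonicalDensity_le_const_mul ha hθ hu ha0 hθ0 ha_pos haa (by positivity) hC hσ N z).trans
    (mul_le_mul_of_nonneg_right (pow_le_pow_left₀ (div_pos hC0 ha_pos).le (le_max_left _ _) _)
      (canonicalDensity_nonneg' hfQ0 _ _ z))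

/-! ## §3 The stub -/

/-- Arithmetic of the final constants: with `γ = (κ + 2)/η`,
`((N+1)γ)⁻¹ ((N+1) + (N+1) κ + 1) ≤ η` (`κ ≥ 0`, `η > 0`). -/
theorem budget_arith {κ η : ℝ} (hκ : 0 ≤ κ) (hη : 0 < η) (N : ℕ) :
    (((N : ℝ) + 1) * ((κ + 2) / η))⁻¹ * (1 * ((N : ℝ) + 1) + ((N : ℝ) + 1) * κ + 1) ≤ η := by
  have hN : (0 : ℝ) < (N : ℝ) + 1 := by positivity
  have hκ2 : 0 < κ + 2 := by linarith
  rw [inv_mul_le_iff₀ (by positivity)]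
  have h1 : 1 * ((N : ℝ) + 1) + ((N : ℝ) + 1) * κ + 1 ≤ ((N : ℝ) + 1) * (κ + 2) := by
    nlinarith
  calc 1 * ((N : ℝ) + 1) + ((N : ℝ) + 1) * κ + 1 ≤ ((N : ℝ) + 1) * (κ + 2) := h1
    _ = ((N : ℝ) + 1) * ((κ + 2) / η) * η := by field_simp

/-- **STUB 3 of line `plaque-thinning-count-ld` (entropy transfer at time zero).** The equilibrium exponential
moment of the untagged-activity tail sum implies its mean smallness under the true local Gibbs law: reference
`G_N = gibbs σ 1 θ₁ N Φ` with `θ₁ = 2 sup θ₀` (pointwise `dλ₀/dG_N ≤ Λ^{N+1}`, `exists_canonicalDensity_le_pow_mul`),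
the elementary entropy inequality `lintegral_withDensity_le_of_exp_moment` with `t = γ F`, `B = N + 1` (`δ = 1`),
`L = Λ^{N+1}`, and `γ = (log Λ + 2)/η`; measurability along `λ₀ ≪ G_N`. The Euler solution and the `t = 0` law of
large numbers are not used (the estimate is a priori). -/
theorem stub_entropyTransfer : EquilibriumUntaggedActivityLMGF → UntaggedActivityTails := by
  intro hE a₀ θ₀ u₀ ha hθ hu ha0 hθ0
  obtain ⟨θ₁, hθ₁, Λ, hΛ, hdom⟩ := exists_canonicalDensity_le_pow_mul ha hθ hu ha0 hθ0
  obtain ⟨σ₁, hσ₁, hE⟩ := hE 1 θ₁ one_pos hθ₁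
  refine ⟨min σ₁ (1 / 2), lt_min hσ₁ (by norm_num), ?_⟩
  intro σ hσ hσlt T ρ θ u _ Φ _ t _ y hy
  have hσ₁' : σ < σ₁ := hσlt.trans_le (min_le_left _ _)
  have hσ2 : σ ≤ 1 / 2 := (hσlt.trans_le (min_le_right _ _)).le
  obtain ⟨V₀, hV₀, hE⟩ := hE σ hσ hσ₁' y hy
  refine ⟨V₀, hV₀, ?_⟩
  intro V hV Θ hΘ K η hη
  set κ : ℝ := Real.log Λ with hκ
  have hκ0 : 0 ≤ κ := Real.log_nonneg hΛ
  have hγ : 0 < (κ + 2) / η := by positivity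
  obtain ⟨τ₀, hτ₀, hE⟩ := hE V hV Θ hΘ K ((κ + 2) / η) hγ 1 one_pos
  refine ⟨τ₀, hτ₀, fun τ hτ => ?_⟩
  obtain ⟨N₀, hE⟩ := hE τ hτ
  refine ⟨N₀, fun N hN s hs => ?_⟩
  obtain ⟨hmeas, hmom⟩ := hE N hN (Φ N) s hs.1
  -- the two laws
  have hac : localGibbsLaw σ a₀ u₀ θ₀ N (Φ N) ≪ gibbs σ 1 θ₁ N (Φ N) :=
    localGibbsLaw_absolutelyContinuous_localGibbsLaw continuous_const continuous_const continuous_const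
      (fun _ => one_pos) (fun _ => hθ₁) a₀ u₀ θ₀ hσ2 N (Φ N)
  refine ⟨hmeas.mono_ac hac, ?_⟩
  haveI : IsProbabilityMeasure (localGibbsLaw σ a₀ u₀ θ₀ N (Φ N)) :=
    isProbabilityMeasure_localGibbsLaw ha hθ hu ha0 hθ0 hσ2 N (Φ N)
  -- densities
  set F : Cfg N → ℝ := fun z => ∑ i : Fin (N + 1), tailFn V (uncAct Θ y K (Φ N) τ s i z) with hF
  set p : Cfg N → ℝ := canonicalDensity (Torus.geometry (Fin 3)) (hsDiameter σ N) (N + 1)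
    (localGibbsProfile a₀ u₀ θ₀) with hp
  set q : Cfg N → ℝ := canonicalDensity (Torus.geometry (Fin 3)) (hsDiameter σ N) (N + 1)
    (localGibbsProfile (fun _ => 1) (fun _ => (0 : V3)) (fun _ => θ₁)) with hq
  have hPeq : localGibbsLaw σ a₀ u₀ θ₀ N (Φ N) =
      (volume : Measure (Cfg N)).withDensity fun z => ENNReal.ofReal (p z) := by
    rw [localGibbsLaw_eq]; rfl
  have hQeq : gibbs σ 1 θ₁ N (Φ N) = (volume : Measure (Cfg N)).withDensity fun z => ENNReal.ofReal (q z) := by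
    unfold gibbs; rw [localGibbsLaw_eq]; rfl
  have hpm : Measurable p := measurable_canonicalDensity _ _ (measurable_localGibbsProfile ha hθ hu)
  have hqm : Measurable q :=
    measurable_canonicalDensity _ _ (measurable_localGibbsProfile continuous_const continuous_const continuous_const)
  have hp0 : ∀ z, 0 ≤ p z := fun z =>
    canonicalDensity_nonneg' (fun w => localGibbsProfile_nonneg (fun x => (ha0 x).le) (fun x => (hθ0 x).le) w) _ _ z
  have hq0 : ∀ z, 0 ≤ q z := fun z =>
    canonicalDensity_nonneg' (fun w => localGibbsProfile_nonneg (fun _ => zero_le_one) (fun _ => hθ₁.le) w) _ _ z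
  have hL : (1 : ℝ) ≤ Λ ^ (N + 1) := one_le_pow₀ hΛ
  have hpq : ∀ z, p z ≤ Λ ^ (N + 1) * q z := fun z => hdom σ hσ2 N z
  have hPu : ((volume : Measure (Cfg N)).withDensity fun z => ENNReal.ofReal (p z)) Set.univ ≤ 1 := by
    rw [← hPeq]; exact prob_le_one
  have hB : (0 : ℝ) ≤ 1 * ((N : ℝ) + 1) := by positivity
  have hmom' : ∫⁻ z, ENNReal.ofReal (Real.exp ((κ + 2) / η * F z))
      ∂((volume : Measure (Cfg N)).withDensity fun z => ENNReal.ofReal (q z)) ≤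
      ENNReal.ofReal (Real.exp (1 * ((N : ℝ) + 1))) := by
    rw [← hQeq]; exact hmom
  have hkey := lintegral_withDensity_le_of_exp_moment hpm hqm hp0 hq0 hL hpq hPu
    (fun z => (κ + 2) / η * F z) hB hmom'
  rw [← hPeq, Real.log_pow] at hkey
  -- `(N+1)⁻¹ F = ((N+1) γ)⁻¹ · (γ F)`
  have hsplit : ∀ z, ENNReal.ofReal (((N : ℝ) + 1)⁻¹ * F z) =
      ENNReal.ofReal ((((N : ℝ) + 1) * ((κ + 2) / η))⁻¹) * ENNReal.ofReal ((κ + 2) / η * F z) := fun z => by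
    rw [← ENNReal.ofReal_mul (inv_nonneg.2 (by positivity))]
    congr 1
    field_simp
  show ∫⁻ z, ENNReal.ofReal (((N : ℝ) + 1)⁻¹ * F z) ∂(localGibbsLaw σ a₀ u₀ θ₀ N (Φ N)) ≤ ENNReal.ofReal η
  simp_rw [hsplit]
  rw [lintegral_const_mul' _ _ ENNReal.ofReal_ne_top]
  calc ENNReal.ofReal ((((N : ℝ) + 1) * ((κ + 2) / η))⁻¹) *
        ∫⁻ z, ENNReal.ofReal ((κ + 2) / η * F z) ∂(localGibbsLaw σ a₀ u₀ θ₀ N (Φ N))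
      ≤ ENNReal.ofReal ((((N : ℝ) + 1) * ((κ + 2) / η))⁻¹) *
          ENNReal.ofReal (1 * ((N : ℝ) + 1) + ((N + 1 : ℕ) : ℝ) * κ + 1) := mul_le_mul_right hkey _
    _ = ENNReal.ofReal ((((N : ℝ) + 1) * ((κ + 2) / η))⁻¹ *
          (1 * ((N : ℝ) + 1) + ((N : ℝ) + 1) * κ + 1)) := by
        rw [← ENNReal.ofReal_mul (inv_nonneg.2 (by positivity))]
        push_cast
        ring_nf
    _ ≤ ENNReal.ofReal η := ENNReal.ofReal_le_ofReal (budget_arith hκ0 hη N)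

/-- Unfolding lemma for this file's copy of the global Gibbs reference: `gibbs σ a θ N Φ` is the local Gibbs law at the constant profiles
`(a, 0, θ)` (appended, cycle 1; also triggers the farm rebuild of this module, whose olean was missing). -/
theorem gibbs_eq_localGibbsLaw (σ a θ : ℝ) (N : ℕ) (Φ : Flow σ N) :
    gibbs σ a θ N Φ = localGibbsLaw σ (fun _ => a) (fun _ => (0 : V3)) (fun _ => θ) N Φ := rfl

end Summit.AtomisticToContinuum.HydrodynamicLimit.Theorems.CollisionActivityTailsEntropyTransfer

end
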